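import Mathlib.Topology.Algebra.Nonarchimedean.AdicTopology
import Mathlib.RingTheory.AdicCompletion.Basic
import Mathlib.RingTheory.Regular.RegularSequence
import Literature.NumberTheory.GaloisRepresentations.GaloisRep
import Literature.NumberTheory.EllipticCurves.Newforms
import Literature.NumberTheory.EllipticCurves.GlobalMinimalModel
import HarnessLib

/-!
# The universal deformation Hecke algebra `T^Σ_𝔪ρ̄ ≅ R_Σ(ρ̄)` of a modular absolutely irreducible
# `ρ̄ : G_ℚ → GL₂(k)`, all levels at `p` allowed — the INTERFACE (Fouquet–Wan 2021 §2.1–§2.2,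
# Fouquet 2025 §2.4.1)

Topic `NumberTheory/GaloisRepresentations`. Definition item `defn-UniversalDeformationHeckeAlgebra`
(wanted by route `BirchSwinnertonDyer/UniversalToricDescent`, crux `ToricTransportModThree`: to type a
universal zeta element over `T^Σ_𝔪ρ̄ ⊗̂ Λ_ac`, the anticyclotomic fundamental-line transport, and the
point `x_E` of an elliptic curve; and by the tree's `EllipticCurves/Fouquet2025/*` facts, which today
quantify over congruent PAIRS of curves instead of over the ring).

## Mathematics (what the sources print)

Fix an odd prime `p`, a finite set of primes `Σ ∋ p` and `ρ̄ : G_{ℚ,Σ} → GL₂(k)` absolutely irreducible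
and modular ([FouquetWan2021] §2.1, p. 12 of arXiv v3: "an absolutely irreducible and modular (hence odd)
Galois representation unramified outside `Σ`"; [Fouquet2025EquivariantTNC] §2.4.1, p. 14). For an
allowable, sufficiently small tame level `U^{(p)}` maximal outside `Σ`, the local factor at `𝔪_ρ̄` of
the `p`-adic Hecke algebra generated by the `T(ℓ)` (`S(ℓ)`, `⟨ℓ⟩`), `ℓ ∉ Σ`, in the inverse limit over
ALL levels `U_p` at `p`,
`T^Σ_𝔪ρ̄ := lim←_{U_p} T(U_p U^{(p)})_{𝔪ρ̄}` ([Fouquet2025EquivariantTNC] §2.4.1 p. 15; [FouquetWan2021]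
§2.1 p. 12, there as endomorphisms of completed cohomology `H¹_ét(U, 𝒪)`), is a complete noetherian
local ring which
* carries a `G_{ℚ,Σ}`-representation `ρ_Σ : G_{ℚ,Σ} → Aut(T_Σ) ≃ GL₂(T^Σ_𝔪ρ̄)` on a free rank-two
  module `T_Σ`, "uniquely characterized up to isomorphism by the requirement that
  `tr(ρ_Σ(Fr(ℓ))) = T(ℓ)` for all `ℓ ∉ Σ`" ([FouquetWan2021] §2.1 p. 12, citing Carayol;
  [Fouquet2025EquivariantTNC] p. 15 "there exists a `G_{ℚ,Σ}`-representation `T_Σ` with coefficients in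
  `T^Σ_𝔪ρ̄` with residual representation isomorphic to `ρ̄`");
* is topologically generated by the Hecke operators: "there is a map `R_Σ(ρ̄) → T^Σ_𝔪ρ̄` which is
  surjective as its image contains … `tr(ρ_Σ(Fr(ℓ))) = T_ℓ` for all `ℓ ∉ Σ`" ([FouquetWan2021] §2.2.2
  p. 14);
* under [FouquetWan2021, Assumption 2.1] (= [Fouquet2025EquivariantTNC, Ass. 2.9] up to wording) is a
  flat, reduced, complete-intersection `𝒪`-algebra of Krull dimension `4` ISOMORPHIC TO THE UNIVERSAL
  DEFORMATION RING `R_Σ(ρ̄)` of deformations of `ρ̄` unramified outside `Σ`, in which the points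
  classical up to a twist are Zariski-dense ([FouquetWan2021] Prop. 2.4, Cor. 2.5, Prop. 2.6, pp. 14–16;
  [Fouquet2025EquivariantTNC] p. 15: "Motivic points of `T^Σ_𝔪ρ̄` form a Zariski-dense set. The ring
  `T^Σ_𝔪ρ̄` is the universal deformation ring representing deformations of `ρ̄` unramified outside `Σ`
  and which are attached to eigencuspforms for `U^{(p)}` at de Rham points." — there `U^{(p)}` is not
  necessarily sufficiently small, whence the extra condition; the UNCONDITIONED `R_Σ(ρ̄) ≅ T^Σ_𝔪ρ̄` of
  this interface is [FouquetWan2021] Prop. 2.6 for `U` allowable and sufficiently small), and is finite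
  free over a three-variable power-series ring `Λ_f = 𝒪[[X₁,X₂,X₃]]`,
  `X_i ↦ x_i` a regular sequence ([FouquetWan2021] Cor. 2.7, p. 16; §1.2.2);
* has MOTIVIC (classical) POINTS: "A local morphism `λ : T^Σ_𝔪ρ̄ → ℚ̄_p` is motivic if it is equal to
  the trace of the `G_{ℚ,Σ}`-representation `ρ_g` attached to an eigencuspform
  `g ∈ S_{k′}(U′_p U^{(p)})` for some compact open subgroup `U′_p ⊂ GL₂(ℚ_p)` and some integer
  `k′ ≥ 2` up to twist by an integer power `r` of the cyclotomic character and a finite order character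
  `χ` of `Gal(ℚ_∞/ℚ)`. Equivalently, `λ` is a motivic point … if it is up to twist the system of
  eigenvalues of an eigencuspform of weight [at least] 2" ([Fouquet2025EquivariantTNC] §2.4.1 p. 15;
  [FouquetWan2021] §2.2.1 p. 13: "classical" = the system of eigenvalues `λ_f` of a normalized
  eigencuspform `f ∈ S_k(U)`, `k ≥ 2`; "classical up to a twist"); to a point `λ` with values in `S` is
  attached `T(λ) := T_Σ ⊗_{T^Σ_𝔪ρ̄,λ} S`, `ρ_λ = λ ∘ ρ_Σ`, "characterized uniquely (up to isomorphism) by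
  the fact that `tr(ρ_λ(Fr(ℓ))) = λ(T_ℓ)` for all `ℓ ∉ Σ`" ([FouquetWan2021] p. 12;
  [Fouquet2025EquivariantTNC] p. 15 "let `T(λ)` be the `G_{ℚ,Σ}`-representation `T_Σ ⊗_{T^Σ_𝔪ρ̄,λ} S`").

## What this file defines (interface = "hypothesis structure"; NOTHING is asserted to exist)

* `IsResidueOf 𝒪 b β` — the scalar `b ∈ ℚ̄_p` reduces to `β ∈ k` along the coefficient maps
  `𝒪 → k`, `𝒪 → ℚ̄_p` (the entrywise condition of `ReducesTo` in `CrystallineDeformationRing`, which is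
  not imported here to keep the import closure small).
* `IsClassicalHeckeEigensystem p S b`, `IsMotivicHeckeEigensystem p S b` — a function
  `b : ℕ → ℚ̄_p` (read only at primes `ℓ ∉ S`) IS the system of `T(ℓ)`-eigenvalues of a normalised
  Hecke eigen-cuspform of weight `k′ ≥ 2` and level `Γ₁(M)` (or `Γ₀(M)`) with every prime factor of `M`
  in `S`, transported along an embedding `ι : ℚ̄_p →+* ℂ` (classical); resp. such a system twisted by
  `χ_cyc^r · χ`, `χ` a Dirichlet character of `p`-power conductor and `p`-power order (motivic). Stated
  on the tree's `CuspForm (Gamma1 M) k′`, `IsHeckeEigenform`, `IsNormalized`, `heckeEigenvalue`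
  (`EllipticCurves/Newforms.lean`).
* `HeckeEigensystemReducesTo 𝒪 S ρ̄ b` — `b(ℓ) ≡ tr ρ̄(Frob_ℓ)` for primes `ℓ ∉ S` (arithmetic
  Frobenius, tree convention of `GaloisRep.HasFrobCharpolyAt`).
* `UniversalDeformationHeckeAlgebra p 𝒪 k S ρ̄` — THE INTERFACE: a carrier `T` (commutative
  topological ring, local, noetherian, `𝒪`-algebra, `𝔪_T`-adic and complete, reduced, without
  `p`-torsion), the residue map `T → k`, the Hecke operators `hecke ℓ = T(ℓ)` topologically generating
  `T` over `𝒪`, the universal representation `univRep : Γ_ℚ →ₜ* GL₂(T)` unramified outside `S` with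
  `tr univRep(Frob_ℓ) = T(ℓ)` and residual representation `ρ̄`, the `R = T` property on `ℚ̄_p`-points
  (every lift of `ρ̄` unramified outside `S` is `x ∘ univRep` up to traces for a unique point `x`), the
  modularity-completeness property (every motivic eigensystem congruent to `ρ̄` is a point) and the
  Zariski density of motivic points.
* API (all proved): the structure instances; `residueMap_surjective`, `ker_residueMap`; the
  specialisation `specialize f = f ∘ univRep` (= `T(λ)`/`ρ_λ` of the sources, in the frame of `T_Σ`)
  with `trace_specialize_frob`; the predicates `IsClassicalPoint`, `IsMotivicPoint`; the point
  `pointOfEigensystem` attached to a motivic eigensystem congruent to `ρ̄` with its characterisation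
  and uniqueness; and, for an elliptic curve `E/ℚ` (a globally minimal `WeierstrassCurve ℚ`),
  `ellipticCurveEigensystem E = (ℓ ↦ a_ℓ(E))` and THE POINT `ellipticCurvePoint` (`x_E`) under the two
  hypotheses "modular of level with prime factors in `S`" and "`a_ℓ(E) ≡ tr ρ̄(Frob_ℓ)`" (=
  `ρ̄_{E,p}^{ss} ≅ ρ̄`), with `ellipticCurvePoint_hecke : x_E(T(ℓ)) = a_ℓ(E)`.
* `UniversalDeformationHeckeAlgebra.LambdaAlgebraStructure` — the add-on datum of [FouquetWan2021] Cor. 2.7: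
  an `𝒪`-algebra map `Λ_f = 𝒪[[X₁,X₂,X₃]] → T` sending the variables to a regular sequence in `𝔪_T`
  for which `T` is a finite free `Λ_f`-module (the all-or-none clause on crystalline-short /
  ordinary points over a common point of `Λ_f` is NOT transcribed: no such local conditions here).

## What is NOT claimed, and the printed existence theorem (to be cited by whoever instantiates)

No instance is constructed and no existence fact is stated in this file: Carayol's representation on
the nose and the `R = T` / density theorems are not theorems of the tree, so statements quantify over
`(𝓗 : UniversalDeformationHeckeAlgebra p 𝒪 k S ρ̄)` and every field is a HYPOTHESIS on `𝓗` (house style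
of `Automorphic/POrdinaryHeckeAlgebraGL2.lean`, `PointwiseLiftingRing`). A CONSTRUCTION of the carrier IS
available in the tree and is what an instance should be built from: the completed-cohomology ("big")
Hecke algebra `Automorphic/CompletedCohomologyHeckeAlgebraGLn.lean` (`CompletedCohomologyHeckeAlgebraGLn 𝒰`
for `GL_n` over a number field, its localisation `TameLevel.Localized 𝒰 h 𝔪`, the hypothesis structure
`BigGaloisRepAt` for `ρ_𝔪` and `IsNonEisenstein 𝔪`; here `n = 2`, `K = ℚ`); the companion file
`UniversalDeformationHeckeAlgebraExists.lean` records the printed existence theorem as a named fact in the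
special case `𝒪 = ℤ_p`, `k = 𝔽_p`. For the genuine
`T^Σ_𝔪ρ̄` (with `U` allowable and sufficiently small, so that it depends only on `Σ`,
[Fouquet2025EquivariantTNC] p. 15) the fields are theorems in print as follows: carrier properties,
`univRep`, `hecke`, density — [FouquetWan2021] §2.1 (Carayol) and §2.2.2 p. 14 (surjection
`R_Σ(ρ̄) ↠ T^Σ_𝔪ρ̄`, so `T` is noetherian, complete, topologically generated by the `T(ℓ)`); reduced,
`p`-torsion free (flat over `𝒪`), `R = T`, Zariski density of motivic points — [FouquetWan2021]
Prop. 2.4, Cor. 2.5, Prop. 2.6 UNDER ASSUMPTION 2.1 (`p` odd; `ρ̄|_{G_{ℚ(√p*)}}` absolutely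
irreducible; if `ρ̄|_{G_{ℚ_p}}` is an extension of `χ₂` by `χ₁` then `χ₁⁻¹χ₂ ∉ {1, χ̄_cyc}`), resp.
[Fouquet2025EquivariantTNC] §2.4.1 under Ass. 2.9 (image of `ρ̄` contains a conjugate of `SL₂(𝔽_p)`,
same local condition); modularity completeness — the definition of `T^Σ_𝔪ρ̄` as a limit over all
`U_p` (weight-independence, [Fouquet2025EquivariantTNC] p. 15 "does not depend on the weight `k`")
together with `R = T` for the twisted systems. A consumer wanting the existence as a named fact should
file it with exactly those hypotheses; this interface deliberately does not choose between the two
printed hypothesis sets. Not transcribed as fields (no consumer yet; take them as extra hypotheses where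
needed): the complete-intersection property and the Krull dimension `4` of [FouquetWan2021] Prop. 2.4,
the operators `S(ℓ)`/`⟨ℓ⟩` and `det ρ_Σ`, the zeta morphism `z_Σ` ([Nakamura2023ZetaMorphisms] Thm 1.1 =
[Fouquet2025EquivariantTNC] Thm 2.10) and the universal fundamental line `Δ_Σ` (ibid. Def. 2.11).

## Design notes

* BUNDLED carrier with the structure-field instances registered by `attribute [instance]`, exactly as
  the accepted `PointwiseLiftingRing` / `POrdinaryHeckeAlgebraGL2`; no `instance` declaration, no
  notation.
* `hecke : ℕ → T` is total; only its values at primes `ℓ ∉ S` are constrained (junk elsewhere). The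
  operators `S(ℓ)`/`⟨ℓ⟩` are not separate data: `ℓ S(ℓ) = det univRep(Frob_ℓ)`, and they lie in the
  closure of `𝒪[T(ℓ′) : ℓ′ ∉ S]` (this is the content of the printed surjectivity sentence quoted above),
  so density is stated for the `T(ℓ)` alone, as printed.
* Frobenius elements are ARITHMETIC (`IsArithFrobAt`, tree convention of `GaloisRep.HasFrobCharpolyAt`);
  with the homological normalisation of `T_Σ` this gives, at the point of an elliptic curve `E`,
  `tr = a_ℓ(E)`, `det = ℓ` (the Tate module).
* Points are `𝒪`-algebra maps `x : T → ℚ̄_p` (as in `PointwiseLiftingRing`); such an `x` is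
  automatically local, continuous and valued in the integers of a finite extension of `ℚ_p` (image of a
  complete noetherian local ring with finite residue field, algebraic over `ℤ_p`), which is why the
  uniqueness clauses below are faithful although no continuity is demanded of `x`.
* Coefficients `(𝒪, k)` are general (`𝒪 → ℚ̄_p`, `𝒪 → k`; intended `𝒪 = 𝒪_L ⊆ ℚ̄_p`, `k = 𝒪_L/λ`, e.g.
  `𝒪 = ℤ_[p]`, `k = IsLocalRing.ResidueField ℤ_[p]`); `IsResidueOf` is the intended congruence only
  when `𝒪 → k` is onto (otherwise vacuous at non-liftable residues), as for `ReducesTo`.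
* The level of the eigenform in `IsClassicalHeckeEigensystem` is `Γ₁(M)` OR `Γ₀(M)`: the second
  disjunct is redundant mathematically (`S_k(Γ₀(M)) ⊆ S_k(Γ₁(M))`) but spares consumers holding a
  `CuspForm (Gamma0 N) 2` (e.g. `ModularParametrizationData.f`) the level-restriction lemma, which the
  tree states without proof (`restrictLevel_apply_coe`).

## References

* [FouquetWan2021] O. Fouquet, X. Wan, *The Iwasawa Main Conjecture for universal families of modular
  motives*, arXiv:2107.13726v3: §2.1 (p. 12), §2.2.1 (p. 13), §2.2.2 Assumption 2.1, Lemma 2.2–2.3,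
  Prop. 2.4 (p. 14), Cor. 2.5, Prop. 2.6, Cor. 2.7 (pp. 15–16), §1.2.2 (pp. 9–11).
  [corpus: paper-arxiv-2107.13726 p0012–p0016]
* [Fouquet2025EquivariantTNC] O. Fouquet, *The equivariant Tamagawa number conjectures for modular
  motives with coefficients in Hecke algebras*, Tunisian J. Math. 7 (2025) 791–829 = arXiv:2501.07105v1:
  §2.4.1 (pp. 14–15), Ass. 2.9, Thm 2.10, Def. 2.11 (pp. 15–16). [corpus: paper-arxiv-2501.07105
  p0014–p0016]
* [Nakamura2023ZetaMorphisms] K. Nakamura, Invent. Math. 234 (2023), Thm 1.1 (the zeta morphism over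
  the universal deformation; not transcribed here).
* [BarnetlambEtAl2014] T. Barnet-Lamb, T. Gee, D. Geraghty, R. Taylor, *Potential automorphy and change
  of weight*, Ann. of Math. 179 (2014), §1.3 (reduction of `𝒪_{ℚ̄_l}`-valued representations; the
  convention of `ReducesTo`).
* H. Carayol, *Formes modulaires et représentations galoisiennes à valeurs dans un anneau local
  complet*, Contemp. Math. 165 (1994) (the representation `ρ_Σ` over `T_𝔪`), as cited in
  [FouquetWan2021] §2.1.
* Tree: `Automorphic/CompletedCohomologyHeckeAlgebraGLn.lean` (the constructed big Hecke algebra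
  `𝕋(K^p)` of `GL_n`, `TameLevel.Localized`, `BigGaloisRepAt` — the object a construction of this
  interface should start from), `GaloisRepresentations/GaloisRep.lean` (`FramedGaloisRep`, `IsUnramifiedAt`, `primesAbove`,
  `IsArithFrobAt` convention), `GaloisRepresentations/CrystallineDeformationRing.lean`
  (`PointwiseLiftingRing`, `ReducesTo`: the sibling interface whose conventions are followed),
  `Automorphic/POrdinaryHeckeAlgebraGL2.lean` (the ordinary analogue), `EllipticCurves/Newforms.lean`,
  `EllipticCurves/GlobalMinimalModel.lean` (`WeierstrassCurve.frobeniusTrace`).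
-/

noncomputable section

open scoped NumberField MatrixGroups
open Field IsDedekindDomain IsLocalRing

namespace Literature.NumberTheory.GaloisRepresentations

open Literature.NumberTheory.EllipticCurves.ModularForms CongruenceSubgroup

universe u

/-! ### Residues of `p`-adic numbers along a coefficient ring -/

section Residue

variable {p : ℕ} [Fact p.Prime] (𝒪 : Type u) [CommRing 𝒪] [Algebra 𝒪 (PadicAlgCl p)]
  {k : Type*} [Field k] [Algebra 𝒪 k]

/-- **`b ∈ ℚ̄_p` reduces to `β ∈ k` along `𝒪`**: for every lift `a ∈ 𝒪` of `β` along `𝒪 → k`, the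
element `b` is congruent to the image of `a` in `ℚ̄_p` modulo the maximal ideal `{z : ‖z‖ < 1}` of
`𝒪_{ℚ̄_p}`. In the intended situation (`𝒪 = 𝒪_L ⊆ ℚ̄_p`, `𝒪 → k = 𝒪_L/λ` onto) this says `b ∈ 𝒪_{ℚ̄_p}`
and `b mod 𝔪_{ℚ̄_p} = β` in `k ⊆ 𝔽̄_p`; it is the scalar (entrywise) form of `ReducesTo` of
`CrystallineDeformationRing.lean` ([BLGGT] §1.3: "the reduction `ρ̄₁ = ρ₁ mod 𝔪_{ℚ̄_l}`", read on one
entry). [cite: BarnetlambEtAl2014, §1.3] -/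
def IsResidueOf (b : PadicAlgCl p) (β : k) : Prop :=
  ∀ a : 𝒪, algebraMap 𝒪 k a = β → ‖b - algebraMap 𝒪 (PadicAlgCl p) a‖ < 1

/-- Unfolding lemma for `IsResidueOf` (definitional). [cite: BarnetlambEtAl2014, §1.3] -/
theorem isResidueOf_iff (b : PadicAlgCl p) (β : k) :
    IsResidueOf 𝒪 b β ↔ ∀ a : 𝒪, algebraMap 𝒪 k a = β → ‖b - algebraMap 𝒪 (PadicAlgCl p) a‖ < 1 :=
  Iff.rfl

/-- The image of `a ∈ 𝒪` in `ℚ̄_p` reduces to the image of `a` in `k`, provided `𝒪 → ℚ̄_p` maps the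
kernel of `𝒪 → k` into the open unit ball (the intended situation `λ ↦ 𝔪_{ℚ̄_p}`). [cite: BarnetlambEtAl2014, §1.3] -/
theorem isResidueOf_algebraMap (h𝒪 : ∀ a : 𝒪, algebraMap 𝒪 k a = 0 → ‖algebraMap 𝒪 (PadicAlgCl p) a‖ < 1)
    (a : 𝒪) : IsResidueOf 𝒪 (algebraMap 𝒪 (PadicAlgCl p) a) (algebraMap 𝒪 k a) := by
  intro a' ha'
  rw [← map_sub]
  exact h𝒪 _ (by rw [map_sub, ha', sub_self])

end Residue

/-! ### Systems of Hecke eigenvalues away from `S`: classical and motivic -/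

section Eigensystems

variable (p : ℕ) [Fact p.Prime] (S : Finset ℕ)

/-- **Classical Hecke eigensystem** (away from `S`): `b : ℕ → ℚ̄_p` is, at the primes `ℓ ∉ S`, the
system of `T(ℓ)`-eigenvalues of a normalised Hecke eigen-cuspform `g` of some weight `k′ ≥ 2` and some
level `Γ₁(M)` — or `Γ₀(M)`, a redundant convenience, see the module docstring — all of whose prime
factors lie in `S` (classically: `g ∈ S_{k′}(U′_p U^{(p)})` for the tame level `U^{(p)}` maximal outside
`S` and ANY level `U′_p` at `p ∈ S`), read through an embedding `ι : ℚ̄_p →+* ℂ`: `ι(b ℓ) = a_ℓ(g)`.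
[FouquetWan2021] §2.2.1: "classical if there exists a (necessarily unique) normalized eigencuspform
`f ∈ S_k(U)` of weight `k ≥ 2` whose system of eigenvalues `λ_f` coincides with [it]".
[cite: FouquetWan2021, §2.2.1 (p. 13)] [cite: Fouquet2025EquivariantTNC, §2.4.1 (p. 15)] -/
def IsClassicalHeckeEigensystem (b : ℕ → PadicAlgCl p) : Prop :=
  ∃ (M : ℕ) (_ : NeZero M) (k' : ℤ) (ι : PadicAlgCl p →+* ℂ),
    (∀ q : ℕ, q.Prime → q ∣ M → q ∈ S) ∧ 2 ≤ k' ∧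
      ((∃ g : CuspForm (Gamma1 M) k', IsHeckeEigenform g ∧ IsNormalized g ∧
          ∀ ℓ : ℕ, ℓ.Prime → ℓ ∉ S → ι (b ℓ) = heckeEigenvalue g ℓ) ∨
        (∃ g : CuspForm (Gamma0 M) k', IsHeckeEigenform g ∧ IsNormalized g ∧
          ∀ ℓ : ℕ, ℓ.Prime → ℓ ∉ S → ι (b ℓ) = heckeEigenvalue g ℓ))

/-- **Motivic Hecke eigensystem** (away from `S`): `b` is a classical Hecke eigensystem `c` twisted by
`χ_cyc^r · χ` for an integer `r` and a Dirichlet character `χ` of conductor dividing `p^m` and of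
`p`-power order (a finite-order character of `Gal(ℚ_∞/ℚ)`, `ℚ_∞` the cyclotomic `ℤ_p`-extension),
i.e. `b ℓ = c ℓ · χ(ℓ) · ℓ^r` for primes `ℓ ∉ S` (the trace of `ρ_g ⊗ χ χ_cyc^r` on an arithmetic
Frobenius at `ℓ`). [Fouquet2025EquivariantTNC] §2.4.1: "motivic if it is equal to the trace of the
`G_{ℚ,Σ}`-representation `ρ_g` attached to an eigencuspform `g ∈ S_{k′}(U′_p U^{(p)})` … up to twist by
an integer power `r` of the cyclotomic character and a finite order character `χ` of `Gal(ℚ_∞/ℚ)`";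
[FouquetWan2021] §2.2.1 "classical up to a twist".
[cite: Fouquet2025EquivariantTNC, §2.4.1 (p. 15)] [cite: FouquetWan2021, §2.2.1 (p. 13)] -/
def IsMotivicHeckeEigensystem (b : ℕ → PadicAlgCl p) : Prop :=
  ∃ (c : ℕ → PadicAlgCl p) (r : ℤ) (m : ℕ) (χ : DirichletCharacter (PadicAlgCl p) (p ^ m)),
    IsClassicalHeckeEigensystem p S c ∧ χ ^ (p ^ m) = 1 ∧
      ∀ ℓ : ℕ, ℓ.Prime → ℓ ∉ S → b ℓ = c ℓ * χ (ℓ : ZMod (p ^ m)) * (ℓ : PadicAlgCl p) ^ r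

variable {p S}

/-- A classical Hecke eigensystem is motivic (`r = 0`, `χ = 1`). [cite: Fouquet2025EquivariantTNC, §2.4.1 (p. 15)] -/
theorem IsClassicalHeckeEigensystem.isMotivic {b : ℕ → PadicAlgCl p}
    (h : IsClassicalHeckeEigensystem p S b) : IsMotivicHeckeEigensystem p S b := by
  refine ⟨b, 0, 0, 1, h, one_pow _, fun ℓ _ _ => ?_⟩
  have hu : IsUnit ((ℓ : ℕ) : ZMod (p ^ 0)) :=
    (ZMod.isUnit_iff_coprime ℓ (p ^ 0)).mpr (by rw [pow_zero]; exact Nat.coprime_one_right ℓ)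
  rw [zpow_zero, mul_one, MulChar.one_apply hu, mul_one]

/-- Only the values at primes outside `S` matter (classical): the printed notion reads the eigenvalues
`T(ℓ)`, `ℓ ∉ Σ` only. [cite: FouquetWan2021, §2.2.1 (p. 13)] -/
theorem IsClassicalHeckeEigensystem.congr {b b' : ℕ → PadicAlgCl p}
    (h : IsClassicalHeckeEigensystem p S b) (hb' : ∀ ℓ : ℕ, ℓ.Prime → ℓ ∉ S → b' ℓ = b ℓ) :
    IsClassicalHeckeEigensystem p S b' := by
  obtain ⟨M, hM, k', ι, hMS, hk', hg⟩ := h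
  refine ⟨M, hM, k', ι, hMS, hk', ?_⟩
  rcases hg with ⟨g, hge, hgn, hgb⟩ | ⟨g, hge, hgn, hgb⟩
  · exact Or.inl ⟨g, hge, hgn, fun ℓ hℓ hℓS => by rw [hb' ℓ hℓ hℓS]; exact hgb ℓ hℓ hℓS⟩
  · exact Or.inr ⟨g, hge, hgn, fun ℓ hℓ hℓS => by rw [hb' ℓ hℓ hℓS]; exact hgb ℓ hℓ hℓS⟩

/-- Only the values at primes outside `S` matter (motivic). [cite: Fouquet2025EquivariantTNC, §2.4.1 (p. 15)] -/
theorem IsMotivicHeckeEigensystem.congr {b b' : ℕ → PadicAlgCl p}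
    (h : IsMotivicHeckeEigensystem p S b) (hb' : ∀ ℓ : ℕ, ℓ.Prime → ℓ ∉ S → b' ℓ = b ℓ) :
    IsMotivicHeckeEigensystem p S b' := by
  obtain ⟨c, r, m, χ, hc, hχ, hbc⟩ := h
  exact ⟨c, r, m, χ, hc, hχ, fun ℓ hℓ hℓS => (hb' ℓ hℓ hℓS).trans (hbc ℓ hℓ hℓS)⟩

/-- **The eigensystem `b` is congruent to `ρ̄`**: for every prime `ℓ ∉ S`, every prime `𝔓` of `ℤ̄`
above `ℓ` and every arithmetic Frobenius `σ` at `𝔓`, `b ℓ` reduces along `𝒪` to `tr ρ̄(σ)` (meaningful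
for `ρ̄` unramified outside `S`, the situation of the interface below: `isUnramifiedAt_univRep` with
`residueMap_univRep`). For the eigensystem of an eigenform `g` this is "`ρ̄_g^{ss} ≅ ρ̄`", i.e. `λ_g`
belongs to the maximal ideal `𝔪_ρ̄` ([FouquetWan2021] §2.1: `T(ℓ) mod 𝔪_ρ̄ = tr ρ̄(Fr(ℓ))`).
[cite: FouquetWan2021, §2.1 (p. 12)] [cite: Fouquet2025EquivariantTNC, §2.4.1 (p. 14)] -/
def HeckeEigensystemReducesTo (𝒪 : Type u) [CommRing 𝒪] [Algebra 𝒪 (PadicAlgCl p)] {k : Type*} [Field k]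
    [Algebra 𝒪 k] [TopologicalSpace k] (S : Finset ℕ) (ρbar : FramedGaloisRep ℚ k 2)
    (b : ℕ → PadicAlgCl p) : Prop :=
  ∀ ℓ : ℕ, ℓ.Prime → ℓ ∉ S → ∀ v : HeightOneSpectrum (𝓞 ℚ), ((ℓ : ℕ) : 𝓞 ℚ) ∈ v.asIdeal →
    ∀ 𝔓 ∈ v.primesAbove, ∀ σ : absoluteGaloisGroup ℚ, IsArithFrobAt (𝓞 ℚ) σ 𝔓 →
      IsResidueOf 𝒪 (b ℓ) ((ρbar σ : GL (Fin 2) k) : Matrix (Fin 2) (Fin 2) k).trace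

end Eigensystems

/-! ### The interface -/

/-- **The universal deformation Hecke algebra `T^Σ_𝔪ρ̄ ≅ R_Σ(ρ̄)` of `ρ̄ : G_ℚ → GL₂(k)` with tame level
maximal outside `S` and ALL levels at `p`** — interface ("hypothesis structure"; see the module
docstring for what each field transcribes and for the printed existence theorem, which is NOT claimed).
Parameters: the prime `p`, coefficients `𝒪 → ℚ̄_p`, `𝒪 → k` (residue field), the finite set of primes
`S ∋ p` (`Σ` of the sources; fields `mem`, `prime_of_mem`) and the residual representation
`ρ̄ : Γ_ℚ →ₜ* GL₂(k)`. Fields: the carrier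
`T` with its commutative-algebra properties ([FouquetWan2021] Prop. 2.4, Cor. 2.5: flat, reduced,
complete local noetherian); `residueMap : T → k`; the Hecke operators `hecke ℓ = T(ℓ)`, `ℓ ∉ S`,
topologically generating `T` over `𝒪` ([FouquetWan2021] §2.1, §2.2.2 p. 14); the universal
representation `univRep = ρ_Σ` (in a basis of the free rank-two module `T_Σ`), continuous, unramified
outside `S`, with `tr ρ_Σ(Frob_ℓ) = T(ℓ)` ([FouquetWan2021] §2.1, Carayol) and residual representation
`ρ̄` ([Fouquet2025EquivariantTNC] p. 15); `R = T` on `ℚ̄_p`-points ([FouquetWan2021] Prop. 2.6, for `U`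
allowable and sufficiently small); every motivic eigensystem congruent to `ρ̄` is a point, uniquely
(all levels at `p`: [Fouquet2025EquivariantTNC] §2.4.1); motivic points are Zariski-dense in the reduced
ring `T` ([FouquetWan2021] Prop. 2.6; [Fouquet2025EquivariantTNC] p. 15).
[cite: FouquetWan2021, §2.1–§2.2 (pp. 12–16), Prop. 2.4, Cor. 2.5, Prop. 2.6] [cite: Fouquet2025EquivariantTNC, §2.4.1 (pp. 14–15)] -/
structure UniversalDeformationHeckeAlgebra (p : ℕ) [Fact p.Prime] (𝒪 : Type) [CommRing 𝒪]
    [Algebra 𝒪 (PadicAlgCl p)] (k : Type) [Field k] [Algebra 𝒪 k] [TopologicalSpace k]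
    (S : Finset ℕ) (ρbar : FramedGaloisRep ℚ k 2) : Type 1 where
  /-- The carrier: the local Hecke algebra `T = T^Σ_𝔪ρ̄`. -/
  T : Type
  /-- `T` is a commutative ring. -/
  [commRing : CommRing T]
  /-- `T` is a topological space (the `𝔪_T`-adic topology, `isAdic`). -/
  [topologicalSpace : TopologicalSpace T]
  /-- `T` is a topological ring. -/
  [isTopologicalRing : IsTopologicalRing T]
  /-- `T` is local. -/
  [isLocalRing : IsLocalRing T]
  /-- `T` is noetherian (a quotient of `R_Σ(ρ̄)`). -/
  [isNoetherianRing : IsNoetherianRing T]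
  /-- `T` is an `𝒪`-algebra. -/
  [algebra : Algebra 𝒪 T]
  /-- `p ∈ S` ("`Σ` … whose elements are `p` and …"). -/
  mem : p ∈ S
  /-- `S` is a set of PRIMES ("a finite set of finite primes", [FouquetWan2021] §2.1): a `0 ∈ S` would
  make "unramified outside `S`" (`isUnramifiedAt_univRep`, the premise of
  `existsUnique_point_of_deformation`) vacuous, since `(0 : 𝓞 ℚ)` lies in every `v.asIdeal`. -/
  prime_of_mem : ∀ ℓ ∈ S, ℓ.Prime
  /-- the topology of `T` is the `𝔪_T`-adic topology -/
  isAdic : IsAdic (maximalIdeal T)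
  /-- `T` is `𝔪_T`-adically complete (and separated) -/
  isAdicComplete : IsAdicComplete (maximalIdeal T) T
  /-- `T` is reduced ([FouquetWan2021] Cor. 2.5; [Fouquet2025EquivariantTNC] p. 7 "local, reduced") -/
  isReduced : IsReduced T
  /-- `T` has no `p`-torsion (it is `𝒪`-flat, [FouquetWan2021] Prop. 2.4) -/
  torsionFree : ∀ t : T, (p : T) * t = 0 → t = 0
  /-- the residue map `T → k` of the maximal ideal `𝔪_ρ̄`, an `𝒪`-algebra homomorphism -/
  residueMap : T →ₐ[𝒪] k
  /-- the Hecke operators: `hecke ℓ = T(ℓ)` for primes `ℓ ∉ S` (unconstrained junk at other `ℓ`) -/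
  hecke : ℕ → T
  /-- `T` is topologically generated over `𝒪` by the `T(ℓ)`, `ℓ ∉ S` prime ([FouquetWan2021] §2.1
  and §2.2.2 p. 14: the image of `R_Σ(ρ̄) → T` "contains … `T_ℓ` for all `ℓ ∉ Σ`", hence is onto) -/
  dense_adjoin_hecke : Dense ((Algebra.adjoin 𝒪 (hecke '' {ℓ : ℕ | ℓ.Prime ∧ ℓ ∉ S}) :
    Subalgebra 𝒪 T) : Set T)
  /-- the universal representation `ρ_Σ : Γ_ℚ →ₜ* GL₂(T)` (Carayol), in a basis of `T_Σ` -/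
  univRep : FramedGaloisRep ℚ T 2
  /-- `ρ_Σ` is unramified at the places outside `S` (it is a representation of `G_{ℚ,Σ}`) -/
  isUnramifiedAt_univRep : ∀ v : HeightOneSpectrum (𝓞 ℚ),
    (∀ ℓ ∈ S, ((ℓ : ℕ) : 𝓞 ℚ) ∉ v.asIdeal) → univRep.IsUnramifiedAt v
  /-- `tr ρ_Σ(Frob_ℓ) = T(ℓ)` for every prime `ℓ ∉ S` and every arithmetic Frobenius at `ℓ` -/
  trace_univRep_frob : ∀ ℓ : ℕ, ℓ.Prime → ℓ ∉ S → ∀ v : HeightOneSpectrum (𝓞 ℚ),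
    ((ℓ : ℕ) : 𝓞 ℚ) ∈ v.asIdeal → ∀ 𝔓 ∈ v.primesAbove, ∀ σ : absoluteGaloisGroup ℚ,
      IsArithFrobAt (𝓞 ℚ) σ 𝔓 →
        ((univRep σ : GL (Fin 2) T) : Matrix (Fin 2) (Fin 2) T).trace = hecke ℓ
  /-- `ρ_Σ` reduces to `ρ̄` modulo `𝔪_T` (entrywise, in the chosen frames) -/
  residueMap_univRep : ∀ (σ : absoluteGaloisGroup ℚ) (i j : Fin 2),
    residueMap (((univRep σ : GL (Fin 2) T) : Matrix (Fin 2) (Fin 2) T) i j) =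
      ((ρbar σ : GL (Fin 2) k) : Matrix (Fin 2) (Fin 2) k) i j
  /-- `R = T` on `ℚ̄_p`-points ([FouquetWan2021] Prop. 2.6): every continuous `ρ : Γ_ℚ → GL₂(𝒪_{ℚ̄_p})`
  reducing (entrywise) to `ρ̄` and unramified outside `S` has the traces of `x ∘ ρ_Σ` for exactly one
  `𝒪`-algebra point `x : T → ℚ̄_p` -/
  existsUnique_point_of_deformation : ∀ ρ : FramedGaloisRep ℚ (PadicAlgCl p) 2,
    (∀ (σ : absoluteGaloisGroup ℚ) (i j : Fin 2),
      IsResidueOf 𝒪 (((ρ σ : GL (Fin 2) (PadicAlgCl p)) : Matrix (Fin 2) (Fin 2) (PadicAlgCl p)) i j)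
        (((ρbar σ : GL (Fin 2) k) : Matrix (Fin 2) (Fin 2) k) i j)) →
    (∀ v : HeightOneSpectrum (𝓞 ℚ), (∀ ℓ ∈ S, ((ℓ : ℕ) : 𝓞 ℚ) ∉ v.asIdeal) → ρ.IsUnramifiedAt v) →
      ∃! x : T →ₐ[𝒪] PadicAlgCl p, ∀ σ : absoluteGaloisGroup ℚ,
        x ((univRep σ : GL (Fin 2) T) : Matrix (Fin 2) (Fin 2) T).trace =
          ((ρ σ : GL (Fin 2) (PadicAlgCl p)) : Matrix (Fin 2) (Fin 2) (PadicAlgCl p)).trace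
  /-- modularity with all levels at `p` ([Fouquet2025EquivariantTNC] §2.4.1): every motivic Hecke
  eigensystem of tame level in `S` congruent to `ρ̄` is the eigensystem `ℓ ↦ x(T(ℓ))` of exactly one point
  `x` -/
  existsUnique_point_of_eigensystem : ∀ b : ℕ → PadicAlgCl p, IsMotivicHeckeEigensystem p S b →
    HeckeEigensystemReducesTo 𝒪 S ρbar b →
      ∃! x : T →ₐ[𝒪] PadicAlgCl p, ∀ ℓ : ℕ, ℓ.Prime → ℓ ∉ S → x (hecke ℓ) = b ℓ
  /-- motivic points are Zariski-dense in the reduced ring `T` ([FouquetWan2021] Prop. 2.6;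
  [Fouquet2025EquivariantTNC] p. 15): an element killed by every motivic point is `0` -/
  eq_zero_of_forall_motivic : ∀ t : T,
    (∀ x : T →ₐ[𝒪] PadicAlgCl p, IsMotivicHeckeEigensystem p S (fun ℓ => x (hecke ℓ)) → x t = 0) →
      t = 0

namespace UniversalDeformationHeckeAlgebra

attribute [instance] commRing topologicalSpace isTopologicalRing isLocalRing isNoetherianRing algebra

variable {p : ℕ} [Fact p.Prime] {𝒪 : Type} [CommRing 𝒪] [Algebra 𝒪 (PadicAlgCl p)] {k : Type}
  [Field k] [Algebra 𝒪 k] [TopologicalSpace k] {S : Finset ℕ} {ρbar : FramedGaloisRep ℚ k 2}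
  (𝓗 : UniversalDeformationHeckeAlgebra p 𝒪 k S ρbar)

/-! #### The residue field -/

/-- `p` is a non-zero-divisor of `T` (field `torsionFree`: `T` is `𝒪`-flat, [FouquetWan2021] Prop. 2.4).
[cite: FouquetWan2021, Prop. 2.4 (p. 14)] -/
theorem isSMulRegular_natCast : IsSMulRegular 𝓗.T (p : 𝓗.T) :=
  fun r s h => sub_eq_zero.mp (𝓗.torsionFree (r - s) (by simpa [mul_sub, sub_eq_zero] using h))

/-- If `𝒪 → k` is onto (e.g. `k = 𝒪/λ`), the residue map `T → k` is onto (`T/𝔪_ρ̄ = k`).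
[cite: FouquetWan2021, §2.1 (p. 12)] -/
theorem residueMap_surjective (hk : Function.Surjective (algebraMap 𝒪 k)) :
    Function.Surjective 𝓗.residueMap := fun β => by
  obtain ⟨a, rfl⟩ := hk β
  exact ⟨algebraMap 𝒪 𝓗.T a, 𝓗.residueMap.commutes a⟩

/-- If `𝒪 → k` is onto, the kernel of the residue map is the maximal ideal of `T`: `T/𝔪_T = k`.
[cite: FouquetWan2021, §2.1 (p. 12)] -/
theorem ker_residueMap (hk : Function.Surjective (algebraMap 𝒪 k)) :
    RingHom.ker (𝓗.residueMap : 𝓗.T →+* k) = maximalIdeal 𝓗.T :=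
  eq_maximalIdeal (RingHom.ker_isMaximal_of_surjective (𝓗.residueMap : 𝓗.T →+* k)
    (𝓗.residueMap_surjective hk))

/-- The residual trace: `tr ρ_Σ(σ) mod 𝔪_T = tr ρ̄(σ)`. [cite: Fouquet2025EquivariantTNC, §2.4.1 (p. 15)] -/
theorem residueMap_trace_univRep (σ : absoluteGaloisGroup ℚ) :
    𝓗.residueMap ((𝓗.univRep σ : GL (Fin 2) 𝓗.T) : Matrix (Fin 2) (Fin 2) 𝓗.T).trace =
      ((ρbar σ : GL (Fin 2) k) : Matrix (Fin 2) (Fin 2) k).trace := by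
  simp only [Matrix.trace, Matrix.diag_apply, map_sum, 𝓗.residueMap_univRep]

/-- For a prime `ℓ ∉ S`, `T(ℓ) mod 𝔪_T = tr ρ̄(Frob_ℓ)` — the defining property of the maximal ideal
`𝔪_ρ̄` ("`T(ℓ) mod 𝔪_ρ̄ = tr ρ̄(Fr(ℓ))`", [FouquetWan2021] §2.1). [cite: FouquetWan2021, §2.1 (p. 12)] -/
theorem residueMap_hecke {ℓ : ℕ} (hℓ : ℓ.Prime) (hℓS : ℓ ∉ S) {v : HeightOneSpectrum (𝓞 ℚ)}
    (hv : ((ℓ : ℕ) : 𝓞 ℚ) ∈ v.asIdeal) {𝔓 : Ideal (absIntegers (𝓞 ℚ) ℚ)} (h𝔓 : 𝔓 ∈ v.primesAbove)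
    {σ : absoluteGaloisGroup ℚ} (hσ : IsArithFrobAt (𝓞 ℚ) σ 𝔓) :
    𝓗.residueMap (𝓗.hecke ℓ) = ((ρbar σ : GL (Fin 2) k) : Matrix (Fin 2) (Fin 2) k).trace := by
  rw [← 𝓗.trace_univRep_frob ℓ hℓ hℓS v hv 𝔓 h𝔓 σ hσ, residueMap_trace_univRep]

/-! #### Specialisations `T(λ) = T_Σ ⊗_λ S`, `ρ_λ = λ ∘ ρ_Σ` -/

/-- **Specialisation** of the universal representation along a ring homomorphism `f : T → A`: the
representation `ρ_f = f ∘ ρ_Σ : Γ_ℚ → GL₂(A)` — [FouquetWan2021] §2.1: "To a specialization `λ : T → S`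
is attached the `G_{ℚ,Σ}`-representation `(T_λ, ρ_λ, S)` defined by `ρ_λ = λ ∘ ρ_Σ`";
[Fouquet2025EquivariantTNC] p. 15: `T(λ) = T_Σ ⊗_{T,λ} S`. (In the frame of `T_Σ`; no topology on `A`
is needed.) [cite: FouquetWan2021, §2.1 (p. 12)] [cite: Fouquet2025EquivariantTNC, §2.4.1 (p. 15)] -/
def specialize {A : Type*} [CommRing A] (f : 𝓗.T →+* A) : absoluteGaloisGroup ℚ →* GL (Fin 2) A :=
  (Matrix.GeneralLinearGroup.map f).comp 𝓗.univRep.toMonoidHom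

/-- Unfolding lemma: the matrix of `specialize f σ` is the entrywise image of that of `ρ_Σ(σ)`
(`ρ_λ = λ ∘ ρ_Σ`). [cite: FouquetWan2021, §2.1 (p. 12)] -/
@[simp] theorem coe_specialize_apply {A : Type*} [CommRing A] (f : 𝓗.T →+* A)
    (σ : absoluteGaloisGroup ℚ) :
    ((𝓗.specialize f σ : GL (Fin 2) A) : Matrix (Fin 2) (Fin 2) A) =
      ((𝓗.univRep σ : GL (Fin 2) 𝓗.T) : Matrix (Fin 2) (Fin 2) 𝓗.T).map f := rfl

/-- The trace of a specialisation is the image of the universal trace (`ρ_λ = λ ∘ ρ_Σ`).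
[cite: FouquetWan2021, §2.1 (p. 12)] -/
theorem trace_specialize {A : Type*} [CommRing A] (f : 𝓗.T →+* A) (σ : absoluteGaloisGroup ℚ) :
    ((𝓗.specialize f σ : GL (Fin 2) A) : Matrix (Fin 2) (Fin 2) A).trace =
      f ((𝓗.univRep σ : GL (Fin 2) 𝓗.T) : Matrix (Fin 2) (Fin 2) 𝓗.T).trace := by
  simp only [coe_specialize_apply, Matrix.trace, Matrix.diag_apply, Matrix.map_apply, map_sum]

/-- "`tr(ρ_λ(Fr(ℓ))) = λ(T_ℓ)` for all `ℓ ∉ Σ`" ([FouquetWan2021] §2.1): the trace of `ρ_f` on an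
arithmetic Frobenius at a prime `ℓ ∉ S` is `f(T(ℓ))`. [cite: FouquetWan2021, §2.1 (p. 12)] -/
theorem trace_specialize_frob {A : Type*} [CommRing A] (f : 𝓗.T →+* A) {ℓ : ℕ} (hℓ : ℓ.Prime)
    (hℓS : ℓ ∉ S) {v : HeightOneSpectrum (𝓞 ℚ)} (hv : ((ℓ : ℕ) : 𝓞 ℚ) ∈ v.asIdeal)
    {𝔓 : Ideal (absIntegers (𝓞 ℚ) ℚ)} (h𝔓 : 𝔓 ∈ v.primesAbove) {σ : absoluteGaloisGroup ℚ}
    (hσ : IsArithFrobAt (𝓞 ℚ) σ 𝔓) :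
    ((𝓗.specialize f σ : GL (Fin 2) A) : Matrix (Fin 2) (Fin 2) A).trace = f (𝓗.hecke ℓ) := by
  rw [trace_specialize, 𝓗.trace_univRep_frob ℓ hℓ hℓS v hv 𝔓 h𝔓 σ hσ]

/-- A specialisation is unramified outside `S` (inertia at `v ∉ S` maps to `1`). [cite: FouquetWan2021, §2.1 (p. 12)] -/
theorem specialize_eq_one_of_mem_inertia {A : Type*} [CommRing A] (f : 𝓗.T →+* A)
    {v : HeightOneSpectrum (𝓞 ℚ)} (hv : ∀ ℓ ∈ S, ((ℓ : ℕ) : 𝓞 ℚ) ∉ v.asIdeal)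
    {𝔓 : Ideal (absIntegers (𝓞 ℚ) ℚ)} (h𝔓 : 𝔓 ∈ v.primesAbove) {σ : absoluteGaloisGroup ℚ}
    (hσ : σ ∈ 𝔓.inertia (absoluteGaloisGroup ℚ)) : 𝓗.specialize f σ = 1 := by
  have h1 : 𝓗.univRep σ = 1 := 𝓗.isUnramifiedAt_univRep v hv 𝔓 h𝔓 σ hσ
  simp [specialize, h1]

/-! #### Classical and motivic points -/

/-- The point `x : T → ℚ̄_p` is **classical**: its eigensystem `ℓ ↦ x(T(ℓ))` is a classical Hecke
eigensystem. [cite: FouquetWan2021, §2.2.1 (p. 13)] -/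
def IsClassicalPoint (x : 𝓗.T →ₐ[𝒪] PadicAlgCl p) : Prop :=
  IsClassicalHeckeEigensystem p S fun ℓ => x (𝓗.hecke ℓ)

/-- The point `x : T → ℚ̄_p` is **motivic** (classical up to a twist).
[cite: Fouquet2025EquivariantTNC, §2.4.1 (p. 15)] [cite: FouquetWan2021, §2.2.1 (p. 13)] -/
def IsMotivicPoint (x : 𝓗.T →ₐ[𝒪] PadicAlgCl p) : Prop :=
  IsMotivicHeckeEigensystem p S fun ℓ => x (𝓗.hecke ℓ)

/-- A classical point is motivic. [cite: Fouquet2025EquivariantTNC, §2.4.1 (p. 15)] -/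
theorem IsClassicalPoint.isMotivicPoint {x : 𝓗.T →ₐ[𝒪] PadicAlgCl p} (h : 𝓗.IsClassicalPoint x) :
    𝓗.IsMotivicPoint x :=
  IsClassicalHeckeEigensystem.isMotivic h

/-- Two points with the same Hecke eigenvalues `x(T(ℓ))`, `ℓ ∉ S`, one of them motivic and congruent to
`ρ̄`, are equal (uniqueness clause of `existsUnique_point_of_eigensystem`). [cite: Fouquet2025EquivariantTNC, §2.4.1 (p. 15)] -/
theorem point_ext {x y : 𝓗.T →ₐ[𝒪] PadicAlgCl p} (hx : 𝓗.IsMotivicPoint x)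
    (hred : HeckeEigensystemReducesTo 𝒪 S ρbar fun ℓ => x (𝓗.hecke ℓ))
    (h : ∀ ℓ : ℕ, ℓ.Prime → ℓ ∉ S → y (𝓗.hecke ℓ) = x (𝓗.hecke ℓ)) : y = x :=
  (𝓗.existsUnique_point_of_eigensystem _ hx hred).unique h fun _ _ _ => rfl

/-- **The point of a motivic eigensystem**: for a motivic Hecke eigensystem `b` of tame level in `S`
congruent to `ρ̄`, the unique point `x_b : T → ℚ̄_p` with `x_b(T(ℓ)) = b(ℓ)`, `ℓ ∉ S`
(field `existsUnique_point_of_eigensystem`). [cite: Fouquet2025EquivariantTNC, §2.4.1 (p. 15)] -/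
def pointOfEigensystem (b : ℕ → PadicAlgCl p) (hb : IsMotivicHeckeEigensystem p S b)
    (hred : HeckeEigensystemReducesTo 𝒪 S ρbar b) : 𝓗.T →ₐ[𝒪] PadicAlgCl p :=
  (𝓗.existsUnique_point_of_eigensystem b hb hred).exists.choose

/-- Defining property of `pointOfEigensystem`: `x_b(T(ℓ)) = b(ℓ)` for primes `ℓ ∉ S`. [cite: Fouquet2025EquivariantTNC, §2.4.1 (p. 15)] -/
theorem pointOfEigensystem_hecke (b : ℕ → PadicAlgCl p) (hb : IsMotivicHeckeEigensystem p S b)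
    (hred : HeckeEigensystemReducesTo 𝒪 S ρbar b) {ℓ : ℕ} (hℓ : ℓ.Prime) (hℓS : ℓ ∉ S) :
    𝓗.pointOfEigensystem b hb hred (𝓗.hecke ℓ) = b ℓ :=
  (𝓗.existsUnique_point_of_eigensystem b hb hred).exists.choose_spec ℓ hℓ hℓS

/-- Uniqueness of `pointOfEigensystem`: any point with eigensystem `b` is `x_b`. [cite: Fouquet2025EquivariantTNC, §2.4.1 (p. 15)] -/
theorem eq_pointOfEigensystem (b : ℕ → PadicAlgCl p) (hb : IsMotivicHeckeEigensystem p S b)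
    (hred : HeckeEigensystemReducesTo 𝒪 S ρbar b) {y : 𝓗.T →ₐ[𝒪] PadicAlgCl p}
    (hy : ∀ ℓ : ℕ, ℓ.Prime → ℓ ∉ S → y (𝓗.hecke ℓ) = b ℓ) : y = 𝓗.pointOfEigensystem b hb hred :=
  (𝓗.existsUnique_point_of_eigensystem b hb hred).unique hy
    fun _ hℓ hℓS => 𝓗.pointOfEigensystem_hecke b hb hred hℓ hℓS

/-- `pointOfEigensystem b` is a motivic point. [cite: Fouquet2025EquivariantTNC, §2.4.1 (p. 15)] -/
theorem isMotivicPoint_pointOfEigensystem (b : ℕ → PadicAlgCl p)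
    (hb : IsMotivicHeckeEigensystem p S b) (hred : HeckeEigensystemReducesTo 𝒪 S ρbar b) :
    𝓗.IsMotivicPoint (𝓗.pointOfEigensystem b hb hred) :=
  hb.congr fun _ hℓ hℓS => 𝓗.pointOfEigensystem_hecke b hb hred hℓ hℓS

/-- The trace of Frobenius of the specialisation at `x_b` is `b(ℓ)`: `tr ρ_{x_b}(Frob_ℓ) = b ℓ`
(`T(x_b)` "is" the Galois representation with eigensystem `b`, [FouquetWan2021] p. 13 "By definition,
the `G_{ℚ,Σ}` representations `ρ_λ` and `ρ_{f_λ}` are isomorphic"). [cite: FouquetWan2021, §2.2.1 (p. 13)] -/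
theorem trace_specialize_pointOfEigensystem_frob (b : ℕ → PadicAlgCl p)
    (hb : IsMotivicHeckeEigensystem p S b) (hred : HeckeEigensystemReducesTo 𝒪 S ρbar b) {ℓ : ℕ}
    (hℓ : ℓ.Prime) (hℓS : ℓ ∉ S) {v : HeightOneSpectrum (𝓞 ℚ)} (hv : ((ℓ : ℕ) : 𝓞 ℚ) ∈ v.asIdeal)
    {𝔓 : Ideal (absIntegers (𝓞 ℚ) ℚ)} (h𝔓 : 𝔓 ∈ v.primesAbove) {σ : absoluteGaloisGroup ℚ}
    (hσ : IsArithFrobAt (𝓞 ℚ) σ 𝔓) :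
    ((𝓗.specialize (𝓗.pointOfEigensystem b hb hred : 𝓗.T →+* PadicAlgCl p) σ :
        GL (Fin 2) (PadicAlgCl p)) : Matrix (Fin 2) (Fin 2) (PadicAlgCl p)).trace = b ℓ := by
  rw [𝓗.trace_specialize_frob _ hℓ hℓS hv h𝔓 hσ]
  exact 𝓗.pointOfEigensystem_hecke b hb hred hℓ hℓS

/-! #### The point `x_E` of an elliptic curve -/

/-- The Hecke eigensystem `ℓ ↦ a_ℓ(E) = ℓ + 1 − #Ẽ(𝔽_ℓ)` of a globally minimal Weierstrass curve `E/ℚ`,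
as `p`-adic numbers (tree `WeierstrassCurve.frobeniusTrace`; meaningful at primes of good reduction,
which is where it is read when the bad primes lie in `S`). [folklore] -/
def ellipticCurveEigensystem (W : WeierstrassCurve ℚ) [W.IsGloballyMinimal] : ℕ → PadicAlgCl p :=
  fun ℓ => (W.frobeniusTrace ℓ : PadicAlgCl p)

/-- Unfolding lemma for `ellipticCurveEigensystem` (definitional; `f` "attached to a rational elliptic
curve `E/ℚ`", [Fouquet2025EquivariantTNC] §2.2). [cite: Fouquet2025EquivariantTNC, §2.2 (p. 12)] -/
@[simp] theorem ellipticCurveEigensystem_apply (W : WeierstrassCurve ℚ) [W.IsGloballyMinimal] (ℓ : ℕ) :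
    ellipticCurveEigensystem (p := p) W ℓ = (W.frobeniusTrace ℓ : PadicAlgCl p) := rfl

/-- **The point `x_E` of an elliptic curve `E/ℚ` on `T^Σ_𝔪ρ̄`**, for `E` modular of a level whose prime
factors lie in `S` (hypothesis `hmod`: `ℓ ↦ a_ℓ(E)` is a motivic — e.g. classical, via the weight-two
newform of `E` — Hecke eigensystem of tame level in `S`) and with `ρ̄_{E,p}^{ss} ≅ ρ̄` (hypothesis
`hred`: `a_ℓ(E) ≡ tr ρ̄(Frob_ℓ)` for `ℓ ∉ S`): the unique point with `x_E(T(ℓ)) = a_ℓ(E)`, `ℓ ∉ S`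
(the specialisation `T(x_E)` is then the lattice `T_p E` up to isomorphism, by the trace
characterisation of [FouquetWan2021] §2.1 — not restated here).
[cite: Fouquet2025EquivariantTNC, §2.4.1 (p. 15), §2.2 (p. 12)] [cite: FouquetWan2021, §2.1 (p. 12)] -/
def ellipticCurvePoint (W : WeierstrassCurve ℚ) [W.IsGloballyMinimal]
    (hmod : IsMotivicHeckeEigensystem p S (ellipticCurveEigensystem (p := p) W))
    (hred : HeckeEigensystemReducesTo 𝒪 S ρbar (ellipticCurveEigensystem (p := p) W)) :
    𝓗.T →ₐ[𝒪] PadicAlgCl p :=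
  𝓗.pointOfEigensystem _ hmod hred

/-- Defining property of `x_E`: `x_E(T(ℓ)) = a_ℓ(E)` for primes `ℓ ∉ S`. [cite: Fouquet2025EquivariantTNC, §2.4.1 (p. 15)] -/
theorem ellipticCurvePoint_hecke (W : WeierstrassCurve ℚ) [W.IsGloballyMinimal]
    (hmod : IsMotivicHeckeEigensystem p S (ellipticCurveEigensystem (p := p) W))
    (hred : HeckeEigensystemReducesTo 𝒪 S ρbar (ellipticCurveEigensystem (p := p) W))
    {ℓ : ℕ} (hℓ : ℓ.Prime) (hℓS : ℓ ∉ S) :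
    𝓗.ellipticCurvePoint W hmod hred (𝓗.hecke ℓ) = (W.frobeniusTrace ℓ : PadicAlgCl p) :=
  𝓗.pointOfEigensystem_hecke _ hmod hred hℓ hℓS

/-- `x_E` is a motivic point. [cite: Fouquet2025EquivariantTNC, §2.4.1 (p. 15)] -/
theorem isMotivicPoint_ellipticCurvePoint (W : WeierstrassCurve ℚ) [W.IsGloballyMinimal]
    (hmod : IsMotivicHeckeEigensystem p S (ellipticCurveEigensystem (p := p) W))
    (hred : HeckeEigensystemReducesTo 𝒪 S ρbar (ellipticCurveEigensystem (p := p) W)) :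
    𝓗.IsMotivicPoint (𝓗.ellipticCurvePoint W hmod hred) :=
  𝓗.isMotivicPoint_pointOfEigensystem _ hmod hred

/-- Two curves with the same eigensystem away from `S` (e.g. isogenous curves) have the same point (a
point is "characterized uniquely … by … `λ(T_ℓ)` for all `ℓ ∉ Σ`"). [cite: FouquetWan2021, §2.1 (p. 12)] -/
theorem ellipticCurvePoint_congr (W W' : WeierstrassCurve ℚ) [W.IsGloballyMinimal] [W'.IsGloballyMinimal]
    (hmod : IsMotivicHeckeEigensystem p S (ellipticCurveEigensystem (p := p) W))
    (hred : HeckeEigensystemReducesTo 𝒪 S ρbar (ellipticCurveEigensystem (p := p) W))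
    (hmod' : IsMotivicHeckeEigensystem p S (ellipticCurveEigensystem (p := p) W'))
    (hred' : HeckeEigensystemReducesTo 𝒪 S ρbar (ellipticCurveEigensystem (p := p) W'))
    (h : ∀ ℓ : ℕ, ℓ.Prime → ℓ ∉ S → W.frobeniusTrace ℓ = W'.frobeniusTrace ℓ) :
    𝓗.ellipticCurvePoint W hmod hred = 𝓗.ellipticCurvePoint W' hmod' hred' :=
  𝓗.eq_pointOfEigensystem _ hmod' hred' fun ℓ hℓ hℓS => by
    rw [ellipticCurvePoint_hecke _ _ _ _ hℓ hℓS, ellipticCurveEigensystem_apply, h ℓ hℓ hℓS]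

/-! #### The `Λ_f`-structure ([FouquetWan2021] Cor. 2.7) -/

/-- **`Λ_f`-structure on `T`** ([FouquetWan2021] Cor. 2.7, p. 16; §1.2.2): "Let `Λ_f` be the
power-series ring `𝒪[[X₁,X₂,X₃]]`. Then there is a length `3` regular sequence `(x₁,x₂,x₃)` inside
`T^Σ_𝔪 ≃ R_Σ(ρ̄)` such that the assignment `X_i ↦ x_i` endows `T^Σ_𝔪` with a structure of `Λ_f`-algebra
for which it is finite and free as `Λ_f`-module …" — transcribed as DATA attached to `𝓗`: the
`𝒪`-algebra map `toAlgHom : 𝒪[[X₁,X₂,X₃]] → T` (Mathlib `MvPowerSeries (Fin 3) 𝒪`), the variables going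
to a regular sequence in `𝔪_T` (Mathlib `RingTheory.Sequence.IsRegular`), and an explicit finite basis of
`T` over `Λ_f` through `toAlgHom`. The printed all-or-none clause about crystalline-short / ordinary
classical points over a common point of `Λ_f` is not transcribed (no such local conditions in this
file); the structure "depends on an initial choice of a classical point `ρ_f`" (loc. cit.), whence a
separate datum rather than a field of `𝓗`. [cite: FouquetWan2021, Cor. 2.7 (p. 16)] -/
structure LambdaAlgebraStructure (𝓗 : UniversalDeformationHeckeAlgebra p 𝒪 k S ρbar) : Type where
  /-- the structure map `Λ_f = 𝒪[[X₁,X₂,X₃]] → T`, `X_i ↦ x_i` -/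
  toAlgHom : MvPowerSeries (Fin 3) 𝒪 →ₐ[𝒪] 𝓗.T
  /-- the `x_i` lie in the maximal ideal (the structure map is local) -/
  map_X_mem : ∀ i : Fin 3, toAlgHom (MvPowerSeries.X i) ∈ maximalIdeal 𝓗.T
  /-- `(x₁, x₂, x₃)` is a regular sequence on `T` -/
  isRegular : RingTheory.Sequence.IsRegular 𝓗.T (List.ofFn fun i : Fin 3 => toAlgHom (MvPowerSeries.X i))
  /-- `T` is finite free over `Λ_f`: an explicit basis `e₁, …, e_n` -/
  exists_basis : ∃ (n : ℕ) (e : Fin n → 𝓗.T), ∀ t : 𝓗.T,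
    ∃! c : Fin n → MvPowerSeries (Fin 3) 𝒪, t = ∑ i, toAlgHom (c i) * e i

/-- The structure map of a `Λ_f`-structure is a local homomorphism into `𝔪_T` on the augmentation
ideal: every variable goes to `𝔪_T` (field `map_X_mem`). [cite: FouquetWan2021, Cor. 2.7 (p. 16)] -/
theorem LambdaAlgebraStructure.toAlgHom_X_mem (Λ : 𝓗.LambdaAlgebraStructure) (i : Fin 3) :
    Λ.toAlgHom (MvPowerSeries.X i) ∈ maximalIdeal 𝓗.T :=
  Λ.map_X_mem i

end UniversalDeformationHeckeAlgebra

end Literature.NumberTheory.GaloisRepresentations
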